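import Summits.QuantumFields.YangMills.Theorems.AllWindowsColdBoxBoxHighLineK4PrimeRowSumRows
import Summits.QuantumFields.YangMills.Theorems.AllWindowsColdBoxBoxHighLineK4PrimeRowR4Centred

/-!
# U5 K4′ — the ROW SUM, part 3: row R4′ in the per-row `hKk` currency and `hK4` BY NAME
# (planner ym-idea-2 g18 GO 2026-08-30T01:16:10Z / R4′ rulings 01:20:54Z (planner) and 01:23:01Z (LEAD); LINE-20 U5 ⟨stmt-QuantumFields-24336⟩ — U5 prep, helper-grade)

Extra width seat `ym-line-sfw-p2-w4` (g30).  Part 1 (✓`…K4PrimeRowSum`): `tiltCum4_cutSet_size_of_rows (hR3) (hR4) (hR67) : <hK4>` with R1, R2, R5 and LEAD's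
composition by name; part 2 (✓`…K4PrimeRowSumRows`): the adapters `rowBound_R3`, `rowBound_R67`.  Here:

* ★ `K4RowSum.rowBound_R4` — row R4′ (the `CROSS_P(c_x,c_y;P,N′)` term, CENTRED fourth-moment form), from w2 g33's
  ✓`GaussNormalForm.abs_cross_muSet_rowR4_centred_le` at `N′ := Uᵒ − P`, `ν := C₀·H⁶(1+log H)^m·s³ + Cr·β·H⁴·s⁵` (ν-supplier ✓`abs_tiltU_odd_add_cubicVertex_le`
  + the record remainder); `q₄ := 0`; budget via `s⁶β ≤ 1` (so `s⁶/β³ ≤ L⁴/β⁴`), `L³ ≤ L⁴` and the monomials `H¹⁶L^{4+m}s³β^{−1/2}` (`61θ/4 < 13/8`, θ < 0.1066)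
  and `H¹⁴L⁴s⁵β^{1/2}` (`51θ/4 < 11/8`, θ < 0.1078).  WHY R4′: the landed sup×sup form ✓`abs_cross_muSet_rowR4_le` gives the rows `57θ/4 < 9/8` and
  `47θ/4 < 7/8` at `κ₃ = 1/8 − θ/4`, false on `(0.0745, 1/10)` (bus 2026-08-30T01:19:50Z, confirmed 01:20:54Z/01:22:08Z/01:23:01Z);
* ★★★ `tiltCum4_cutSet_size : <w2 g33's hK4 of ✓landauThirdOrder_of_sizes₂ VERBATIM>` := `tiltCum4_cutSet_size_of_rows rowBound_R3 rowBound_R4 rowBound_R67`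
  — **`hK4` BY NAME**; U5 BY NAME is `landauThirdOrder_of_sizes₂ hK3 tiltCum4_cutSet_size` the moment `hK3` lands (fcl-p3 g27's row-sum with the rows of
  w3 g42 / w5 g24 / w2 g33 / LEAD g78).

No definitions; tree only; standard axioms.  HONEST LABEL: helper-grade bookkeeping for the UNSTAFFED stub U5 — `hK4` (one of the two open SIZE hypotheses of
✓`landauThirdOrder_of_sizes₂`) is proved; `hK3` is NOT; U5 `stub_landauThirdOrder`, ⟨24336⟩, ⟨24004⟩ and this seat's crux ⟨stmt-QuantumFields-22884⟩ remain
OPEN; route AllWindowsColdBox is DRAFT; no crux, rung or summit is proved; **the Yang–Mills mass gap is NOT proved by this file; no summit is proved by a line.**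
-/

set_option autoImplicit false

noncomputable section

open MeasureTheory
open Literature.Probability.LatticeModels (Site)
open Literature.MathematicalPhysics.QuantumLattice (ZdPlaquette plaquettesTouching)
open Literature.MathematicalPhysics.QuantumFieldTheory.AxialGauge (boxEdges)
open Summit.QuantumFields.YangMills.Theorems.WeakCouplingRates (plaq12At)

namespace Summit.QuantumFields.YangMills.Theorems.AllWindowsColdBoxBoxHighLine

namespace K4RowSum

open AssemblyBudget ErrorBudget

/-- ★ **Row R4′ (the CROSS term `CROSS_P(c_x,c_y;P,N′)`, centred fourth-moment form) in the per-row `hKk` currency**, for every bounded tensor `Tc`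
whose triple-form sum approximates `−cubicVertex` to quintic order on small fields: from w2 g33's ✓`GaussNormalForm.abs_cross_muSet_rowR4_centred_le`
at `N′ := Uᵒ − P`, `ν := C₀·H⁶(1+log H)^m·s³ + Cr·β·H⁴·s⁵`; `q₄ := 0`.  Budget: with `s⁶β ≤ 1` (so `s⁶/β³ ≤ L⁴/β⁴`) and `L³ ≤ L⁴` the size is
`≤ 128·√(2C_P)·L²/β² · C_A^{1/4}·B·H²·L²·β^{−1/2} · ν`, i.e. after `×β²H⁸` the monomials `H¹⁶L^{4+m}s³β^{−1/2}` (`61θ/4 < 13/8`, θ < 0.1066) and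
`H¹⁴L⁴s⁵β^{1/2}` (`51θ/4 < 11/8`, θ < 0.1078) — the landed sup×sup R4 (✓`abs_cross_muSet_rowR4_le`) would give `57θ/4 < 9/8` and `47θ/4 < 7/8` instead, false near
`θ = 1/10`; hence R4′. -/
theorem rowBound_R4 : ∀ θ : ℝ, 0 < θ → θ < 1 / 10 → ∀ B Cr : ℝ, ∀ Tc : ZdPlaquette 4 → Fin 4 → Fin 4 → Fin 4 → ℝ, (∀ p i j k, |Tc p i j k| ≤ B) →
    (∀ H : ℕ, 1 ≤ H → ∀ β : ℝ, 0 < β → ∀ s : ℝ, 0 ≤ s → ∀ a ∈ smallField H s,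
      |cubicVertex β H a + β * ∑ p ∈ plaquettesTouching (boxEdges 4 (2 * H + 1)), tripleForm (Tc p) (plaqVar H p.1 p.2.1.1 p.2.1.2 a)| ≤
        Cr * β * (H : ℝ) ^ 4 * s ^ 5) →
    ∃ q : ℝ, ∃ K : ℝ → ℕ → ℝ,
    (∃ β₀ : ℝ, 1 ≤ β₀ ∧ ∀ β : ℝ, β₀ ≤ β → ∀ H : ℕ, 1 ≤ H → β ^ θ ≤ (H : ℝ) → (H : ℝ) ≤ β ^ θ + 1 →
      ∀ D : Set (LandauFree H → E3), MeasurableSet D → D ⊆ smallField H (β ^ ((1 / 8 - θ / 4) - 1 / 2)) → (∀ a, -a ∈ D ↔ a ∈ D) →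
      gaussAvg β H (fun a => 1 - D.indicator (fun _ => (1 : ℝ)) a) ≤ β ^ (-q) →
      gaussAvg β H (fun a => 1 - D.indicator (fun _ => (1 : ℝ)) a) ≤ 1 / 2 → (∀ a ∈ D, |tiltU β H a| ≤ 2) → ∀ x y : Site 4,
      let μD : Measure (LandauFree H → E3) := ((volume : Measure (LandauFree H → E3)).restrict D).withDensity fun a => ENNReal.ofReal (gaussWeight β H a)
      let P : (LandauFree H → E3) → ℝ := fun a => β * ∑ p ∈ plaquettesTouching (boxEdges 4 (2 * H + 1)), tripleForm (Tc p) (plaqVar H p.1 p.2.1.1 p.2.1.2 a)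
      let N : (LandauFree H → E3) → ℝ := fun a => (tiltU β H a - tiltU β H (-a)) / 2 - P a
      let X : (LandauFree H → E3) → ℝ := chartPlaqCost H x 1 2
      let Y : (LandauFree H → E3) → ℝ := chartPlaqCost H y 1 2
      let EP : ((LandauFree H → E3) → ℝ) → ℝ := fun G => Tilt.tiltExp μD P 0 G
      |EP (fun a => (X a - EP X) * (Y a - EP Y) * (P a - EP P) * (N a - EP N)) - EP (fun a => (X a - EP X) * (Y a - EP Y)) * EP (fun a => (P a - EP P) * (N a - EP N))
          - EP (fun a => (X a - EP X) * (P a - EP P)) * EP (fun a => (Y a - EP Y) * (N a - EP N))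
          - EP (fun a => (X a - EP X) * (N a - EP N)) * EP (fun a => (Y a - EP Y) * (P a - EP P))| ≤ K β H) ∧
    (∀ ε : ℝ, 0 < ε → ∃ β₀ : ℝ, 1 ≤ β₀ ∧ ∀ β : ℝ, β₀ ≤ β → ∀ H : ℕ, 1 ≤ H → (H : ℝ) ≤ β ^ θ + 1 → β ^ 2 * (H : ℝ) ^ 8 * K β H ≤ ε) := by
  intro θ hθ hθ' B Cr Tc hTc hrem
  obtain ⟨CP, CA, hCP, hCA, hR4⟩ := GaussNormalForm.abs_cross_muSet_rowR4_centred_le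
  obtain ⟨C₀, c₀, m, hC₀, hc₀, hG⟩ := GaussNormalForm.abs_tiltU_odd_add_cubicVertex_le
  have hB0 : 0 ≤ B := (abs_nonneg _).trans (hTc (((0 : Site 4), ⟨(0, 1), by decide⟩) : ZdPlaquette 4) 0 0 0)
  have hCr : 0 ≤ Cr := by
    have h := hrem 1 le_rfl 1 one_pos 1 zero_le_one 0 (fun e => by simp)
    have : (0 : ℝ) ≤ Cr * 1 * ((1 : ℕ) : ℝ) ^ 4 * 1 ^ 5 := (abs_nonneg _).trans h
    simpa using this
  obtain ⟨b₀, hb₀, hside⟩ := side_budget (κ₃ := 1 / 8 - θ / 4) (c := c₀) hθ (by linarith) (by linarith) hc₀ 0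
  refine ⟨0, fun β H => 128 * Real.sqrt (CP * ((1 + Real.log H) ^ 4 / β ^ 4 + (β ^ ((1 / 8 - θ / 4) - 1 / 2)) ^ 6 / β ^ 3)) *
      (Real.sqrt (Real.sqrt (CA * (B ^ 2 * (H : ℝ) ^ 4 * (1 + Real.log H) ^ 3 / β) ^ 2)) *
        (C₀ * (H : ℝ) ^ 6 * (1 + Real.log H) ^ m * (β ^ ((1 / 8 - θ / 4) - 1 / 2)) ^ 3 + Cr * β * (H : ℝ) ^ 4 * (β ^ ((1 / 8 - θ / 4) - 1 / 2)) ^ 5)),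
    ⟨b₀, hb₀, ?_⟩, ?_⟩
  · intro β hβ H hH hHl hHu D hDm hDs hsym _ hco2 hU x y
    obtain ⟨-, hsH, -, -, hs1⟩ := hside β hβ H hH hHl hHu
    have hβ1 : 1 ≤ β := hb₀.trans hβ
    have hβ0 : 0 < β := by linarith
    set s : ℝ := β ^ ((1 / 8 - θ / 4) - 1 / 2) with hs
    have hs0 : 0 ≤ s := Real.rpow_nonneg hβ0.le _
    have hH1 : (1 : ℝ) ≤ H := by exact_mod_cast hH
    have hL0 : 0 ≤ 1 + Real.log (H : ℝ) := by have := Real.log_nonneg hH1; linarith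
    have mP : Measurable fun a : LandauFree H → E3 =>
        β * ∑ p ∈ plaquettesTouching (boxEdges 4 (2 * H + 1)), tripleForm (Tc p) (plaqVar H p.1 p.2.1.1 p.2.1.2 a) :=
      EdgeChartGaussian.measurable_of_polyCert (EdgeChartGaussian.polyCert_tripleFormSum H β _ Tc hTc)
    have mN : Measurable fun a : LandauFree H → E3 => (tiltU β H a - tiltU β H (-a)) / 2 -
        β * ∑ p ∈ plaquettesTouching (boxEdges 4 (2 * H + 1)), tripleForm (Tc p) (plaqVar H p.1 p.2.1.1 p.2.1.2 a) :=
      (((GaussNormalForm.measurable_tiltU β H).sub ((GaussNormalForm.measurable_tiltU β H).comp measurable_neg)).div_const 2).sub mP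
    have hν0 : 0 ≤ C₀ * (H : ℝ) ^ 6 * (1 + Real.log H) ^ m * s ^ 3 + Cr * β * (H : ℝ) ^ 4 * s ^ 5 := by positivity
    have bN : ∀ a ∈ D, |(tiltU β H a - tiltU β H (-a)) / 2 -
        β * ∑ p ∈ plaquettesTouching (boxEdges 4 (2 * H + 1)), tripleForm (Tc p) (plaqVar H p.1 p.2.1.1 p.2.1.2 a)| ≤
        C₀ * (H : ℝ) ^ 6 * (1 + Real.log H) ^ m * s ^ 3 + Cr * β * (H : ℝ) ^ 4 * s ^ 5 := by
      intro a ha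
      have h1 := hG H hH β s hs0 hsH a (hDs ha)
      have h2 := hrem H hH β hβ0 s hs0 a (hDs ha)
      have hid : (tiltU β H a - tiltU β H (-a)) / 2 -
          β * ∑ p ∈ plaquettesTouching (boxEdges 4 (2 * H + 1)), tripleForm (Tc p) (plaqVar H p.1 p.2.1.1 p.2.1.2 a) =
          ((tiltU β H a - tiltU β H (-a)) / 2 + cubicVertex β H a) -
            (cubicVertex β H a + β * ∑ p ∈ plaquettesTouching (boxEdges 4 (2 * H + 1)), tripleForm (Tc p) (plaqVar H p.1 p.2.1.1 p.2.1.2 a)) := by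
        ring
      rw [hid]
      exact (abs_sub _ _).trans (add_le_add h1 h2)
    exact hR4 H hH β hβ1 _ hs0 hs1 B Tc hTc D hDm hDs (1 / 2) hco2 le_rfl _ mN _ hν0 bN x y
  · intro ε hε
    have hε' : 0 < ε / 2 := half_pos hε
    obtain d₁ := budget_monomial (a := 1) (k := 0) (j := 6) (κ₃ := 1 / 8 - θ / 4) hθ.le (by push_cast; linarith) one_pos 1 0
    obtain m₁ := budget_monomial (a := -(1 / 2)) (k := 16) (j := 3) (κ₃ := 1 / 8 - θ / 4) hθ.le (by push_cast; linarith) hε'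
      (128 * Real.sqrt (2 * CP) * CA ^ ((1 : ℝ) / 4) * B * C₀) (4 + m)
    obtain m₂ := budget_monomial (a := 1 / 2) (k := 14) (j := 5) (κ₃ := 1 / 8 - θ / 4) hθ.le (by push_cast; linarith) hε'
      (128 * Real.sqrt (2 * CP) * CA ^ ((1 : ℝ) / 4) * B * Cr) 4
    obtain ⟨β₀, hβ₀, hall⟩ := exists_forall_and d₁ (exists_forall_and m₁ m₂)
    refine ⟨β₀, hβ₀, fun β hβ H hH hHu => ?_⟩
    obtain ⟨e₁, f₁, f₂⟩ := hall β hβ H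
    replace e₁ := e₁ hH hHu
    replace f₁ := f₁ hH hHu
    replace f₂ := f₂ hH hHu
    have hβ1 : 1 ≤ β := hβ₀.trans hβ
    have hβ0 : 0 < β := by linarith
    have hH1 : (1 : ℝ) ≤ H := by exact_mod_cast hH
    have hL1 : 1 ≤ 1 + Real.log (H : ℝ) := by have := Real.log_nonneg hH1; linarith
    have hL0 : 0 ≤ 1 + Real.log (H : ℝ) := zero_le_one.trans hL1
    set s : ℝ := β ^ ((1 / 8 - θ / 4) - 1 / 2) with hs
    have hs0 : 0 ≤ s := by rw [hs]; exact Real.rpow_nonneg hβ0.le _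
    set L : ℝ := 1 + Real.log (H : ℝ) with hL
    simp only [pow_zero, mul_one, one_mul, Real.rpow_one] at e₁
    -- (i) the plaquette fourth moments: `s⁶/β³ ≤ L⁴/β⁴`, so `√(CP·(L⁴/β⁴ + s⁶/β³)) ≤ √(2CP)·L²/β²`
    set u : ℝ := Real.sqrt (2 * CP) * L ^ 2 * β⁻¹ ^ 2 with hu
    have hu0 : 0 ≤ u := by positivity
    have hsL : s ^ 6 / β ^ 3 ≤ L ^ 4 / β ^ 4 := by
      have h1 : s ^ 6 / β ^ 3 = (s ^ 6 * β) / β ^ 4 := by field_simp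
      rw [h1]
      exact div_le_div_of_nonneg_right (e₁.trans (one_le_pow₀ hL1)) (by positivity)
    have hU : Real.sqrt (CP * (L ^ 4 / β ^ 4 + s ^ 6 / β ^ 3)) ≤ u := by
      have hle : CP * (L ^ 4 / β ^ 4 + s ^ 6 / β ^ 3) ≤ u ^ 2 := by
        have hu2 : u ^ 2 = CP * (2 * (L ^ 4 / β ^ 4)) := by
          rw [hu, mul_pow, mul_pow, Real.sq_sqrt (by positivity)]; field_simp
        rw [hu2]; exact mul_le_mul_of_nonneg_left (by linarith) hCP
      calc Real.sqrt (CP * (L ^ 4 / β ^ 4 + s ^ 6 / β ^ 3)) ≤ Real.sqrt (u ^ 2) := Real.sqrt_le_sqrt hle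
        _ = u := Real.sqrt_sq hu0
    -- (ii) the cubic-polynomial fourth moment: `√(√(CA·A²)) ≤ CA^{1/4}·B·H²·L²·β^{−1/2}`
    set v : ℝ := CA ^ ((1 : ℝ) / 4) * B * (H : ℝ) ^ 2 * L ^ 2 * β ^ (-(1 / 2) : ℝ) with hv
    have hv0 : 0 ≤ v := by positivity
    have hV : Real.sqrt (Real.sqrt (CA * (B ^ 2 * (H : ℝ) ^ 4 * L ^ 3 / β) ^ 2)) ≤ v := by
      have hA0 : 0 ≤ B ^ 2 * (H : ℝ) ^ 4 * L ^ 3 / β := by positivity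
      have hAle : B ^ 2 * (H : ℝ) ^ 4 * L ^ 3 / β ≤ B ^ 2 * (H : ℝ) ^ 4 * L ^ 4 / β :=
        div_le_div_of_nonneg_right (mul_le_mul_of_nonneg_left (pow_le_pow_right₀ hL1 (by norm_num)) (by positivity)) hβ0.le
      have hv4 : v ^ 4 = CA * (B ^ 2 * (H : ℝ) ^ 4 * L ^ 4 / β) ^ 2 := by
        have hc : (CA ^ ((1 : ℝ) / 4)) ^ 4 = CA := by rw [← Real.rpow_natCast, ← Real.rpow_mul hCA]; norm_num
        have hb : (β ^ (-(1 / 2) : ℝ)) ^ 4 = (β ^ 2)⁻¹ := by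
          rw [rpow_pow_eq hβ0.le, show (-(1 / 2) * ((4 : ℕ) : ℝ) : ℝ) = -2 by norm_num, Real.rpow_neg hβ0.le, Real.rpow_two]
        calc v ^ 4 = (CA ^ ((1 : ℝ) / 4)) ^ 4 * B ^ 4 * (H : ℝ) ^ 8 * L ^ 8 * (β ^ (-(1 / 2) : ℝ)) ^ 4 := by rw [hv]; ring
          _ = CA * B ^ 4 * (H : ℝ) ^ 8 * L ^ 8 * (β ^ 2)⁻¹ := by rw [hc, hb]
          _ = _ := by field_simp
      have hle : CA * (B ^ 2 * (H : ℝ) ^ 4 * L ^ 3 / β) ^ 2 ≤ v ^ 4 := by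
        rw [hv4]; exact mul_le_mul_of_nonneg_left (pow_le_pow_left₀ hA0 hAle 2) hCA
      calc Real.sqrt (Real.sqrt (CA * (B ^ 2 * (H : ℝ) ^ 4 * L ^ 3 / β) ^ 2)) ≤ Real.sqrt (Real.sqrt (v ^ 4)) :=
            Real.sqrt_le_sqrt (Real.sqrt_le_sqrt hle)
        _ = v := by rw [show v ^ 4 = (v ^ 2) ^ 2 by ring, Real.sqrt_sq (sq_nonneg _), Real.sqrt_sq hv0]
    -- assemble
    have hν0 : 0 ≤ C₀ * (H : ℝ) ^ 6 * L ^ m * s ^ 3 + Cr * β * (H : ℝ) ^ 4 * s ^ 5 := by positivity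
    have hK : 128 * Real.sqrt (CP * (L ^ 4 / β ^ 4 + s ^ 6 / β ^ 3)) *
        (Real.sqrt (Real.sqrt (CA * (B ^ 2 * (H : ℝ) ^ 4 * L ^ 3 / β) ^ 2)) * (C₀ * (H : ℝ) ^ 6 * L ^ m * s ^ 3 + Cr * β * (H : ℝ) ^ 4 * s ^ 5)) ≤
        128 * u * (v * (C₀ * (H : ℝ) ^ 6 * L ^ m * s ^ 3 + Cr * β * (H : ℝ) ^ 4 * s ^ 5)) :=
      mul_le_mul (mul_le_mul_of_nonneg_left hU (by norm_num)) (mul_le_mul_of_nonneg_right hV hν0) (by positivity) (by positivity)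
    have hb' : β ^ 2 * β⁻¹ ^ 2 = 1 := by field_simp
    have hh : β ^ (1 / 2 : ℝ) = β ^ (-(1 / 2) : ℝ) * β := by
      rw [← Real.rpow_add_one hβ0.ne']; norm_num
    have step : β ^ 2 * (H : ℝ) ^ 8 * (128 * u * (v * (C₀ * (H : ℝ) ^ 6 * L ^ m * s ^ 3 + Cr * β * (H : ℝ) ^ 4 * s ^ 5))) =
        β ^ 2 * β⁻¹ ^ 2 * (128 * Real.sqrt (2 * CP) * CA ^ ((1 : ℝ) / 4) * B * C₀ * (H : ℝ) ^ 16 * L ^ (4 + m) * s ^ 3 * β ^ (-(1 / 2) : ℝ)) +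
          β ^ 2 * β⁻¹ ^ 2 * (128 * Real.sqrt (2 * CP) * CA ^ ((1 : ℝ) / 4) * B * Cr * (H : ℝ) ^ 14 * L ^ 4 * s ^ 5 * (β ^ (-(1 / 2) : ℝ) * β)) := by
      rw [hu, hv]; ring
    calc β ^ 2 * (H : ℝ) ^ 8 * (128 * Real.sqrt (CP * (L ^ 4 / β ^ 4 + s ^ 6 / β ^ 3)) *
          (Real.sqrt (Real.sqrt (CA * (B ^ 2 * (H : ℝ) ^ 4 * L ^ 3 / β) ^ 2)) * (C₀ * (H : ℝ) ^ 6 * L ^ m * s ^ 3 + Cr * β * (H : ℝ) ^ 4 * s ^ 5)))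
        ≤ β ^ 2 * (H : ℝ) ^ 8 * (128 * u * (v * (C₀ * (H : ℝ) ^ 6 * L ^ m * s ^ 3 + Cr * β * (H : ℝ) ^ 4 * s ^ 5))) :=
          mul_le_mul_of_nonneg_left hK (by positivity)
      _ = _ := step
      _ = 128 * Real.sqrt (2 * CP) * CA ^ ((1 : ℝ) / 4) * B * C₀ * (H : ℝ) ^ 16 * L ^ (4 + m) * s ^ 3 * β ^ (-(1 / 2) : ℝ) +
          128 * Real.sqrt (2 * CP) * CA ^ ((1 : ℝ) / 4) * B * Cr * (H : ℝ) ^ 14 * L ^ 4 * s ^ 5 * β ^ (1 / 2 : ℝ) := by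
          rw [hb', one_mul, one_mul, ← hh]
      _ ≤ ε / 2 + ε / 2 := add_le_add f₁ f₂
      _ = ε := by ring

end K4RowSum

/-! ## `hK4` by name -/

open K4RowSum in
/-- ★★★ **`hK4` OF ✓`landauThirdOrder_of_sizes₂ (hK3) (hK4)` BY NAME** — the size of the fourth cumulant `κ₄,₀^{μ_D}(c_x, c_y; tiltU, tiltU)` on every admissible
symmetric cut set at the point of record, with its budget `β²H⁸·K → 0`, for EVERY `0 < θ < 1/10`: the row sum ✓`tiltCum4_cutSet_size_of_rows` fed with the
three adapters of this file (R3 w2 g33, R4′ w2 g33, R6/7 LEAD g78; R1, R2, R5 and the composition inside part 1).  U5 BY NAME is now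
`landauThirdOrder_of_sizes₂ hK3 tiltCum4_cutSet_size` the moment `hK3` lands. -/
theorem tiltCum4_cutSet_size :
    ∀ θ : ℝ, 0 < θ → θ < 1 / 10 → ∃ q : ℝ, ∃ K : ℝ → ℕ → ℝ,
      (∃ β₀ : ℝ, 1 ≤ β₀ ∧ ∀ β : ℝ, β₀ ≤ β → ∀ H : ℕ, 1 ≤ H → β ^ θ ≤ (H : ℝ) → (H : ℝ) ≤ β ^ θ + 1 →
        ∀ D : Set (LandauFree H → E3), MeasurableSet D → D ⊆ smallField H (β ^ ((1 / 8 - θ / 4) - 1 / 2)) → (∀ a, -a ∈ D ↔ a ∈ D) →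
        gaussAvg β H (fun a => 1 - D.indicator (fun _ => (1 : ℝ)) a) ≤ β ^ (-q) →
        gaussAvg β H (fun a => 1 - D.indicator (fun _ => (1 : ℝ)) a) ≤ 1 / 2 → (∀ a ∈ D, |tiltU β H a| ≤ 2) → ∀ x y : Site 4,
        |Tilt.tiltCum4 (((volume : Measure (LandauFree H → E3)).restrict D).withDensity fun a => ENNReal.ofReal (gaussWeight β H a))
            (tiltU β H) 0 (chartPlaqCost H x 1 2) (chartPlaqCost H y 1 2)| ≤ K β H) ∧
      (∀ ε : ℝ, 0 < ε → ∃ β₀ : ℝ, 1 ≤ β₀ ∧ ∀ β : ℝ, β₀ ≤ β → ∀ H : ℕ, 1 ≤ H → (H : ℝ) ≤ β ^ θ + 1 → β ^ 2 * (H : ℝ) ^ 8 * K β H ≤ ε) :=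
  tiltCum4_cutSet_size_of_rows rowBound_R3 rowBound_R4 rowBound_R67

end Summit.QuantumFields.YangMills.Theorems.AllWindowsColdBoxBoxHighLine
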